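import Summits.MatrixMultiplication.MatrixMultiplication.Theorems.FarEdgeDescentFlatCorner
import Summits.MatrixMultiplication.MatrixMultiplication.Theorems.SaturationLadderThinRoof
import HarnessLib

/-!
# Far-edge descent, kernel XXXIV-B: the THIN CEILING of the isolated tower (answer to K48-V)

Route `FarEdgeDescent`, special leaf `FiniteSaturation` (stmt-MatrixMultiplication-23739): helper
kernel, THESES-FREE and def-free; cut of record unchanged.  It reads the certified isolated improvable
squaring tower of `E₃` (`FarEdgeDescentIsolatedSandwich`) in the THIN virtual formats `(1,t,R)` of
lens 1 (`SaturationLadder`, ASK-L2-47 / K48-V: «does the tower certify a thin-excess bound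
`ω(1,t,e^{c/(1−t)}) − (1+e^{c/(1−t)}) ≤ e^{−Ac/(1−t)}` at some `A` BEYOND `θ_S = log(4/3)/log(3/2)`?»).
§1 (every field): the tower's words `⟨a,B,a⟩ ⊕ ⟨1,Q,1⟩` are symmetric, so a plane point `θ = (θ₀,θ₁,θ₂)`
(support function `θ₀ + xθ₁ + yθ₂ ≤ ω(1,x,y)`, lens 1's `plane_le_omegaRect` / `isLUB_plane`) meets the
tower ONLY through its three shadows on the pencil `(1,y,1)`: `(θ₀+θ₂, θ₁)` [flat corner `(2,0)`],
`(θ₀+θ₁, θ₂)`, `(θ₁+θ₂, θ₀)` [cusp `(1,1)`], each sub-tangent for a genuine spectral point.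
§2 (TRUE): `ω(1,t,R) − (1+R) ≤ A·R^(−θ_S)` for all `0 ≤ t ≤ 1`, `R > 0`, ONE constant.  §3 (INSTRUMENT
CEILING): for `t ∈ [1/2,1]`, `R ≥ R₀` the plane point `(1 − τ/3, τ, 1 − ε)`,
`ε = η·R^(−1/(1−κ))`, `τ = (3/2)c_w·ε^κ`, passes EVERY readout at all three shadows (two in the cusp
wedge of kernel XXXIII-B, one by the flat-corner rigidity `τ ≤ 3δ` of kernel XXXIV-A — a point BEYOND
the unit roof, `τ > δ`) with thin excess `≥ η·R^(−θ_S)`.  §4 packages it: for every `c > 0`, `A > θ_S`,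
`t₀ < 1` some `t ∈ [t₀,1)` and admissible plane point beat `e^{−Ac/(1−t)}` at `R = e^{c/(1−t)}`.  So NO:
read thin, the tower certifies exactly the grades `A < θ_S` of its far slot (lens 1 `grades_of_rateBeyond`),
«A_tower = θ_S» at instrument level; the cusp shadows decide the exponent, the flat shadow is rigid.
Refs: Schönhage 1981 §5; Pan 1984 §16; Stothers 2010 Thm. 8; Lotti–Romani 1983; Strassen 1988 Thm. 3.8;
Alman–Li 2026 Prop. 4.2.  Tags: `FiniteSaturation` (h₁) NEC · WEAKER · ATTACKED; K48-V answered (NO).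
-/

set_option linter.dupNamespace false

noncomputable section

open scoped BigOperators

namespace Summit.MatrixMultiplication.MatrixMultiplication.Theorems.FarEdgeDescentThinCeiling

open Literature.Computability.AlgebraicComplexity
open Summit.MatrixMultiplication.MatrixMultiplication.Theorems.FarEdgeDescentImprovableRate
  (improvableKappa_pos_lt_one)
open Summit.MatrixMultiplication.MatrixMultiplication.Theorems.FarEdgeDescentIsolatedSandwich
  (isolatedTower_sandwich)
open Summit.MatrixMultiplication.MatrixMultiplication.Theorems.FarEdgeDescentFlatCorner
open Summit.MatrixMultiplication.MatrixMultiplication.Theorems.SaturationLadderThinRoof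
  (plane_le_omegaRect isLUB_plane)

variable {K : Type} [Field K]

/-! ## §1 The plane certificate: the three shadows of a spectral plane point are sub-tangent -/

/-- Shadow `A = (θ₀+θ₂, θ₁)`: `(θ₀+θ₂) + y·θ₁ ≤ ω(1,y,1)` (the plane at `(x,y) = (y,1)`).
[cite: Strassen1988, Thm. 3.8] [cite: AlmanLi2026, Proposition 4.2] -/
theorem shadow_subtangent₁ {F : SpectralMap K} (hF : IsUniversalSpectralPoint K F) {y : ℝ}
    (hy : 0 ≤ y) :
    (specMMPoint K F 0 + specMMPoint K F 2) + y * specMMPoint K F 1 ≤ omegaRect K 1 y 1 := by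
  have := plane_le_omegaRect hF hy zero_le_one
  linarith

/-- Shadow `B = (θ₀+θ₁, θ₂)`: `(θ₀+θ₁) + y·θ₂ ≤ ω(1,y,1)` (the plane at `(1,y)`, `ω(1,1,y) = ω(1,y,1)`).
[cite: Strassen1988, Thm. 3.8] [cite: LottiRomani1983, Prop. 4.1] -/
theorem shadow_subtangent₂ {F : SpectralMap K} (hF : IsUniversalSpectralPoint K F) {y : ℝ}
    (hy : 0 ≤ y) :
    (specMMPoint K F 0 + specMMPoint K F 1) + y * specMMPoint K F 2 ≤ omegaRect K 1 y 1 := by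
  have := plane_le_omegaRect hF zero_le_one hy
  rw [omegaRect_swap₂₃ K 1 1 y] at this
  linarith

/-- Shadow `C = (θ₁+θ₂, θ₀)`: `(θ₁+θ₂) + y·θ₀ ≤ ω(1,y,1)` (the plane at `(1/y,1/y)` scaled by `y`,
homogeneity `y·ω(1,1/y,1/y) = ω(y,1,1) = ω(1,y,1)`; at `y = 0`: `θ₁+θ₂ ≤ 2 ≤ ω(1,0,1)`).
[cite: Strassen1988, Thm. 3.8] [cite: LottiRomani1983, Thm. 2] -/
theorem shadow_subtangent₃ {F : SpectralMap K} (hF : IsUniversalSpectralPoint K F) {y : ℝ}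
    (hy : 0 ≤ y) :
    (specMMPoint K F 1 + specMMPoint K F 2) + y * specMMPoint K F 0 ≤ omegaRect K 1 y 1 := by
  rcases hy.eq_or_lt with hy0 | hypos
  · rw [← hy0]
    have h1 := (AlmanLi2026.prop42_mem_Icc hF 1).2
    have h2 := (AlmanLi2026.prop42_mem_Icc hF 2).2
    have h3 := add_le_omegaRect₁₃ K 1 0 1
    simp only [zero_mul, add_zero]
    linarith
  · have hyi : 0 ≤ 1 / y := by positivity
    have h := plane_le_omegaRect hF hyi hyi
    have e : omegaRect K y 1 1 = y * omegaRect K 1 (1 / y) (1 / y) := by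
      have := LottiRomani1983_homogeneous (K := K) hy zero_le_one hyi hyi
      rw [mul_one, mul_one_div_cancel hypos.ne'] at this
      exact this
    have hmul := mul_le_mul_of_nonneg_left h hy
    have e2 : y * (specMMPoint K F 0 + 1 / y * specMMPoint K F 1 + 1 / y * specMMPoint K F 2) =
        y * specMMPoint K F 0 + specMMPoint K F 1 + specMMPoint K F 2 := by
      field_simp
    rw [omegaRect_swap₁₂ K 1 y 1, e]
    linarith

/-- **THE PLANE CERTIFICATE.**  If the readouts pass at every sub-tangent point of `y ↦ ω(1,y,1)`
(kernel XXXII-C), every universal spectral point passes every readout at each of its three shadows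
`(θ₀+θ₂,θ₁)`, `(θ₀+θ₁,θ₂)`, `(θ₁+θ₂,θ₀)`. [cite: Strassen1988, Thm. 3.8] [cite: Schonhage1981, §5] -/
theorem plane_certificate (r : ℕ → ℕ) (G : ℕ → ℝ → ℝ → ℝ)
    (hread : ∀ j (s t : ℝ), (∀ y : ℝ, 0 ≤ y → s + y * t ≤ omegaRect K 1 y 1) → G j s t ≤ r j)
    {F : SpectralMap K} (hF : IsUniversalSpectralPoint K F) (j : ℕ) :
    G j (specMMPoint K F 0 + specMMPoint K F 2) (specMMPoint K F 1) ≤ r j ∧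
      G j (specMMPoint K F 0 + specMMPoint K F 1) (specMMPoint K F 2) ≤ r j ∧
      G j (specMMPoint K F 1 + specMMPoint K F 2) (specMMPoint K F 0) ≤ r j :=
  ⟨hread j _ _ fun _ hy => shadow_subtangent₁ hF hy,
    hread j _ _ fun _ hy => shadow_subtangent₂ hF hy,
    hread j _ _ fun _ hy => shadow_subtangent₃ hF hy⟩

/-! ## §2 The true thin excess at exponent exactly `θ_S` (every field) -/

/-- **TRUE THIN EXCESS, exponent `θ_S`, one constant**: `ω_K(1,t,R) − (1+R) ≤ A·R^(−θ_S)` for ALL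
`0 ≤ t ≤ 1`, `R > 0` (`θ_S = κ/(1−κ)`, `κ = log₂(4/3)`): shadow `B` of every spectral point lies in
the upper wedge `θ₀+θ₁−1 ≤ C(1−θ₂)^κ` of the isolated tower (kernel XXXII-D), `C·ε₂^κ − R·ε₂ ≤
C^(1/(1−κ))·R^(−θ_S)`, and `isLUB_plane`. [cite: Schonhage1981, §5] [cite: Pan1984, Props. 16.2–16.5]
[cite: Strassen1988, Thm. 3.8] [cite: LottiRomani1983, Thm. 2] -/
theorem thinExcess_le_rpow :
    ∃ A : ℝ, 0 ≤ A ∧ ∀ t R : ℝ, 0 ≤ t → t ≤ 1 → 0 < R →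
      omegaRect K 1 t R - (1 + R) ≤
        A * R ^ (-(Real.logb 2 ((4 : ℝ) / 3) / (1 - Real.logb 2 ((4 : ℝ) / 3)))) := by
  obtain ⟨hκ0, hκ1⟩ := improvableKappa_pos_lt_one
  obtain ⟨r, Q, L, G, -, -, -, -, -, -, -, -, -, ⟨C, hC0, hC⟩, -, -⟩ := isolatedTower_sandwich K
  refine ⟨C ^ (1 / (1 - Real.logb 2 ((4 : ℝ) / 3))), Real.rpow_nonneg hC0 _, fun t R ht0 ht1 hR => ?_⟩
  have key : ∀ F : SpectralMap K, IsUniversalSpectralPoint K F →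
      specMMPoint K F 0 + t * specMMPoint K F 1 + R * specMMPoint K F 2 ≤
        1 + R + C ^ (1 / (1 - Real.logb 2 ((4 : ℝ) / 3))) *
          R ^ (-(Real.logb 2 ((4 : ℝ) / 3) / (1 - Real.logb 2 ((4 : ℝ) / 3)))) := by
    intro F hF
    have h0 := AlmanLi2026.prop42_mem_Icc hF 0
    have h1 := AlmanLi2026.prop42_mem_Icc hF 1
    have h2 := AlmanLi2026.prop42_mem_Icc hF 2
    have hB : specMMPoint K F 0 + specMMPoint K F 1 - 1 ≤
        C * (1 - specMMPoint K F 2) ^ Real.logb 2 ((4 : ℝ) / 3) := by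
      by_cases hs : 1 ≤ specMMPoint K F 0 + specMMPoint K F 1
      · exact hC _ _ h2.1 h2.2 hs (by linarith [h0.2, h1.2]) fun _ hy => shadow_subtangent₂ hF hy
      · have : 0 ≤ C * (1 - specMMPoint K F 2) ^ Real.logb 2 ((4 : ℝ) / 3) :=
          mul_nonneg hC0 (Real.rpow_nonneg (by linarith [h2.2]) _)
        linarith
    have hopt := rpow_sub_mul_le hκ0 hκ1 hC0 hR (by linarith [h2.2] : 0 ≤ 1 - specMMPoint K F 2)
    have ht : t * specMMPoint K F 1 ≤ specMMPoint K F 1 := by nlinarith [h1.1]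
    linarith
  have hub := (isLUB_plane (K := K) ht0 hR.le).2 (by rintro _ ⟨F, hF, rfl⟩; exact key F hF)
  linarith

/-! ## §3 The thin witness of the `E₃` tower -/

section Chain

variable (r Q L : ℕ → ℕ) (G : ℕ → ℝ → ℝ → ℝ)

/-- `Q_j ≥ 1` along the chain from `Q_0 ≥ 1` (`Q_{j+1} = Q_j² + 2L_j²`). [cite: Pan1984, Props. 16.2–16.5] -/
theorem one_le_Q (h0 : 1 ≤ Q 0) (hsum : ∀ j, Q j + 2 * L j = r j)
    (hL : ∀ j, L (j + 1) = (Q j + L j) ^ 2 - Q j ^ 2) (hr : ∀ j, r (j + 1) = r j ^ 2) :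
    ∀ j, 1 ≤ Q j := by
  intro j
  induction j with
  | zero => exact h0
  | succ j ih =>
    have h := anchor_sq r Q L hsum hL hr j
    have ihR : (1 : ℝ) ≤ ((Q j : ℕ) : ℝ) := by exact_mod_cast ih
    have : (1 : ℝ) ≤ ((Q (j + 1) : ℕ) : ℝ) := by rw [h]; nlinarith [sq_nonneg (((L j : ℕ) : ℝ))]
    exact_mod_cast this

/-- **THE THIN WITNESS (instrument ceiling `θ_S` in every thin format).**  On the `E₃` tower of
record with lower wedge constant `c` (kernel XXXIII-B) there are `η, R₀ > 0` such that for all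
`t ∈ [1/2, 1]`, `R ≥ R₀` the plane point `θ = (1 − τ/3, τ, 1 − ε)`, `ε = η·R^(−1/(1−κ))`,
`τ = (3/2)c·ε^κ`, lies in `[0,1]³`, passes EVERY readout at all three shadows, and has thin excess
`≥ η·R^(−θ_S)`. [cite: Schonhage1981, §5] [cite: Pan1984, Props. 16.2–16.5] [cite: Stothers2010, Thm. 8] -/
theorem thin_witness (h0r : r 0 = 10) (h0Q : Q 0 = 4) (h0G : ∀ s t : ℝ, G 0 s t = (3 : ℝ) ^ s)
    (hsum : ∀ j, Q j + 2 * L j = r j)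
    (hL : ∀ j, L (j + 1) = (Q j + L j) ^ 2 - Q j ^ 2) (hr : ∀ j, r (j + 1) = r j ^ 2)
    (hG : ∀ j (s t : ℝ), G (j + 1) s t = (((Q j : ℕ) : ℝ) ^ t + G j s t) ^ 2 - (((Q j : ℕ) : ℝ) ^ t) ^ 2)
    {c : ℝ} (hc : 0 < c)
    (hw : ∀ s t : ℝ, 1 ≤ s → 0 ≤ t → t ≤ 1 →
      s - 1 ≤ c * (1 - t) ^ Real.logb 2 ((4 : ℝ) / 3) → ∀ j, G j s t ≤ (r j : ℝ) / 2) :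
    ∃ η R₀ : ℝ, 0 < η ∧ 0 < R₀ ∧ ∀ t R : ℝ, 1 / 2 ≤ t → t ≤ 1 → R₀ ≤ R →
      ∃ θ₀ θ₁ θ₂ : ℝ, 0 ≤ θ₀ ∧ θ₀ ≤ 1 ∧ 0 ≤ θ₁ ∧ θ₁ ≤ 1 ∧ 0 ≤ θ₂ ∧ θ₂ ≤ 1 ∧
        (∀ j, G j (θ₀ + θ₂) θ₁ ≤ r j ∧ G j (θ₀ + θ₁) θ₂ ≤ r j ∧ G j (θ₁ + θ₂) θ₀ ≤ r j) ∧
        η * R ^ (-(Real.logb 2 ((4 : ℝ) / 3) / (1 - Real.logb 2 ((4 : ℝ) / 3)))) ≤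
          θ₀ + t * θ₁ + R * θ₂ - (1 + R) := by
  obtain ⟨κ, hκ⟩ : ∃ κ : ℝ, κ = Real.logb 2 ((4 : ℝ) / 3) := ⟨_, rfl⟩
  obtain ⟨hκ0, hκ1⟩ := improvableKappa_pos_lt_one
  rw [← hκ] at hκ0 hκ1 hw ⊢
  have h1κ : 0 < 1 - κ := by linarith
  have hQ1 : ∀ j, 1 ≤ Q j := one_le_Q r Q L (by rw [h0Q]; norm_num) hsum hL hr
  have hrR : ∀ j, (r j : ℝ) / 2 ≤ r j := fun j => half_le_self (Nat.cast_nonneg _)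
  obtain ⟨τC, hτC⟩ : ∃ τC : ℝ, τC = (c * (3 : ℝ) ^ (-κ)) ^ (1 - κ)⁻¹ := ⟨_, rfl⟩
  have h3κ : 0 < (3 : ℝ) ^ (-κ) := Real.rpow_pos_of_pos (by norm_num) _
  have hτCpos : 0 < τC := by rw [hτC]; exact Real.rpow_pos_of_pos (mul_pos hc h3κ) _
  obtain ⟨τm, hτm⟩ : ∃ τm : ℝ, τm = min (1 / 100) τC := ⟨_, rfl⟩
  have hτmpos : 0 < τm := by rw [hτm]; exact lt_min (by norm_num) hτCpos
  have hτm1 : τm ≤ 1 / 100 := by rw [hτm]; exact min_le_left _ _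
  have hτmC : τm ≤ τC := by rw [hτm]; exact min_le_right _ _
  obtain ⟨εC, hεC⟩ : ∃ εC : ℝ, εC = (3 / 2 * c) ^ (1 - κ)⁻¹ := ⟨_, rfl⟩
  have hεCpos : 0 < εC := by rw [hεC]; exact Real.rpow_pos_of_pos (by positivity) _
  obtain ⟨ετ, hετ⟩ : ∃ ετ : ℝ, ετ = (τm / (3 / 2 * c)) ^ κ⁻¹ := ⟨_, rfl⟩
  have hετpos : 0 < ετ := by rw [hετ]; exact Real.rpow_pos_of_pos (by positivity) _
  obtain ⟨εs, hεs⟩ : ∃ εs : ℝ, εs = min (min (1 / 200) εC) ετ := ⟨_, rfl⟩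
  have hεspos : 0 < εs := by rw [hεs]; exact lt_min (lt_min (by norm_num) hεCpos) hετpos
  have hεs1 : εs ≤ 1 / 200 := by rw [hεs]; exact (min_le_left _ _).trans (min_le_left _ _)
  have hεsC : εs ≤ εC := by rw [hεs]; exact (min_le_left _ _).trans (min_le_right _ _)
  have hεsτ : εs ≤ ετ := by rw [hεs]; exact min_le_right _ _
  obtain ⟨η, hη⟩ : ∃ η : ℝ, η = (c / 8) ^ (1 - κ)⁻¹ := ⟨_, rfl⟩
  have hηpos : 0 < η := by rw [hη]; exact Real.rpow_pos_of_pos (by positivity) _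
  have hηpow : η ^ (1 - κ) = c / 8 := by rw [hη]; exact Real.rpow_inv_rpow (by positivity) h1κ.ne'
  obtain ⟨R₀, hR₀⟩ : ∃ R₀ : ℝ, R₀ = (η / εs) ^ (1 - κ) := ⟨_, rfl⟩
  have hR₀pos : 0 < R₀ := by rw [hR₀]; exact Real.rpow_pos_of_pos (div_pos hηpos hεspos) _
  refine ⟨η, R₀, hηpos, hR₀pos, fun t R ht ht1 hR => ?_⟩
  have hRpos : 0 < R := lt_of_lt_of_le hR₀pos hR
  obtain ⟨ε, hε⟩ : ∃ ε : ℝ, ε = η * R ^ (-(1 - κ)⁻¹) := ⟨_, rfl⟩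
  have hεpos : 0 < ε := by rw [hε]; exact mul_pos hηpos (Real.rpow_pos_of_pos hRpos _)
  have hεle : ε ≤ εs := by
    have h1 : R ^ (-(1 - κ)⁻¹) ≤ R₀ ^ (-(1 - κ)⁻¹) :=
      Real.rpow_le_rpow_of_nonpos hR₀pos hR (by rw [neg_nonpos]; exact inv_nonneg.2 h1κ.le)
    have h2 : R₀ ^ (-(1 - κ)⁻¹) = εs / η := by
      rw [hR₀, ← Real.rpow_mul (div_pos hηpos hεspos).le,
        show (1 - κ) * (-(1 - κ)⁻¹) = -1 by field_simp, Real.rpow_neg_one, inv_div]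
    rw [hε]
    calc η * R ^ (-(1 - κ)⁻¹) ≤ η * R₀ ^ (-(1 - κ)⁻¹) := mul_le_mul_of_nonneg_left h1 hηpos.le
      _ = εs := by rw [h2]; field_simp
  obtain ⟨τ, hτ⟩ : ∃ τ : ℝ, τ = 3 / 2 * c * ε ^ κ := ⟨_, rfl⟩
  have hεκpos : 0 < ε ^ κ := Real.rpow_pos_of_pos hεpos _
  have hτpos : 0 < τ := by rw [hτ]; positivity
  have hτle : τ ≤ τm := by
    have h1 : ε ^ κ ≤ ετ ^ κ := Real.rpow_le_rpow hεpos.le (hεle.trans hεsτ) hκ0.le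
    have h2 : ετ ^ κ = τm / (3 / 2 * c) := by
      rw [hετ]; exact Real.rpow_inv_rpow (by positivity) hκ0.ne'
    rw [hτ]
    calc 3 / 2 * c * ε ^ κ ≤ 3 / 2 * c * ετ ^ κ := mul_le_mul_of_nonneg_left h1 (by positivity)
      _ = τm := by rw [h2]; field_simp
  have hτ100 : τ ≤ 1 / 100 := hτle.trans hτm1
  have hετ' : ε ≤ τ := by
    have h1 : ε ^ (1 - κ) ≤ εC ^ (1 - κ) := Real.rpow_le_rpow hεpos.le (hεle.trans hεsC) h1κ.le
    have h2 : εC ^ (1 - κ) = 3 / 2 * c := by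
      rw [hεC]; exact Real.rpow_inv_rpow (by positivity) h1κ.ne'
    have e : ε = ε ^ (1 - κ) * ε ^ κ := by
      rw [← Real.rpow_add hεpos, show 1 - κ + κ = 1 by ring, Real.rpow_one]
    calc ε = ε ^ (1 - κ) * ε ^ κ := e
      _ ≤ 3 / 2 * c * ε ^ κ := mul_le_mul_of_nonneg_right (h1.trans h2.le) hεκpos.le
      _ = τ := by rw [hτ]
  -- the cusp wedge at shadow `C`: `τ − ε ≤ τ ≤ c (τ/3)^κ`
  have hwedgeC : τ ≤ c * (τ / 3) ^ κ := by
    have h1 : τ ^ (1 - κ) ≤ τC ^ (1 - κ) :=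
      Real.rpow_le_rpow hτpos.le (hτle.trans hτmC) h1κ.le
    have h2 : τC ^ (1 - κ) = c * (3 : ℝ) ^ (-κ) := by
      rw [hτC]; exact Real.rpow_inv_rpow (mul_pos hc h3κ).le h1κ.ne'
    have e : τ = τ ^ (1 - κ) * τ ^ κ := by
      rw [← Real.rpow_add hτpos, show 1 - κ + κ = 1 by ring, Real.rpow_one]
    have e2 : c * (τ / 3) ^ κ = c * (3 : ℝ) ^ (-κ) * τ ^ κ := by
      rw [Real.div_rpow hτpos.le (by norm_num), Real.rpow_neg (by norm_num)]
      field_simp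
    rw [e2]
    calc τ = τ ^ (1 - κ) * τ ^ κ := e
      _ ≤ c * (3 : ℝ) ^ (-κ) * τ ^ κ :=
          mul_le_mul_of_nonneg_right (h1.trans h2.le) (Real.rpow_nonneg hτpos.le _)
  have hε200 : ε ≤ 1 / 200 := hεle.trans hεs1
  refine ⟨1 - τ / 3, τ, 1 - ε, by linarith, by linarith, hτpos.le, by linarith, by linarith,
    by linarith, fun j => ⟨?_, ?_, ?_⟩, ?_⟩
  · -- shadow A `(2 − (τ/3 + ε), τ)`: flat-corner rigidity
    rw [show 1 - τ / 3 + (1 - ε) = 2 - (τ / 3 + ε) by ring]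
    exact flatCorner_pass r Q L G h0r h0Q h0G hsum hQ1 hL hr hG (δ := τ / 3 + ε) (τ := τ)
      (by linarith) (by linarith) hτpos.le hτ100 (by linarith) j
  · -- shadow B `(1 + (2/3)τ, 1 − ε)`: lower wedge, `(2/3)τ = c ε^κ`
    refine le_trans (hw _ _ (by linarith) (by linarith) (by linarith) ?_ j) (hrR j)
    rw [show 1 - (1 - ε) = ε by ring, hτ]
    linarith
  · -- shadow C `(1 + τ − ε, 1 − τ/3)`: lower wedge, `τ − ε ≤ c (τ/3)^κ`
    refine le_trans (hw _ _ (by linarith) (by linarith) (by linarith) ?_ j) (hrR j)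
    rw [show 1 - (1 - τ / 3) = τ / 3 by ring]
    linarith
  · -- the excess: `−τ/3 + tτ − Rε ≥ τ/6 − Rε = (c/4)ε^κ − Rε = η R^(−θ_S)`
    have hεκ : ε ^ κ = η ^ κ * R ^ (-(κ / (1 - κ))) := by
      rw [hε, Real.mul_rpow hηpos.le (Real.rpow_nonneg hRpos.le _), ← Real.rpow_mul hRpos.le]
      congr 2
      field_simp
    have hRε : R * ε = η * R ^ (-(κ / (1 - κ))) := by
      rw [hε, mul_left_comm,
        show R * R ^ (-(1 - κ)⁻¹) = R ^ (1 : ℝ) * R ^ (-(1 - κ)⁻¹) by rw [Real.rpow_one],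
        ← Real.rpow_add hRpos]
      congr 2
      field_simp
      ring
    have hηκ : c / 4 * η ^ κ = 2 * η := by
      have e : η ^ κ = η ^ ((1 : ℝ) + -(1 - κ)) := by congr 1; ring
      rw [e, Real.rpow_add hηpos, Real.rpow_one, Real.rpow_neg hηpos.le, hηpow]
      field_simp
      ring
    have hRθ : 0 ≤ R ^ (-(κ / (1 - κ))) := Real.rpow_nonneg hRpos.le _
    have hlow : τ / 6 - R * ε = η * R ^ (-(κ / (1 - κ))) := by
      rw [hτ, hRε, show 3 / 2 * c * ε ^ κ / 6 = (c / 4 * η ^ κ) * R ^ (-(κ / (1 - κ))) by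
        rw [hεκ]; ring, hηκ]
      ring
    nlinarith [mul_nonneg (by linarith : 0 ≤ t - 1 / 2) hτpos.le]

end Chain

/-- **From the rpow-scale witness to the literal K48-V form**: if for `t ∈ [1/2,1]`, `R ≥ R₀` some
admissible plane point has thin excess `≥ η·R^(−θS)`, then for every `c > 0`, `A > θS`, `t₀ < 1` some
`t ∈ [t₀,1)` and admissible point beat `e^{−Ac/(1−t)}` at `R = e^{c/(1−t)}`. [folklore] -/
theorem notCertified_of_witness (r : ℕ → ℕ) (G : ℕ → ℝ → ℝ → ℝ) {θS : ℝ}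
    (W : ∃ η R₀ : ℝ, 0 < η ∧ 0 < R₀ ∧ ∀ t R : ℝ, 1 / 2 ≤ t → t ≤ 1 → R₀ ≤ R →
      ∃ θ₀ θ₁ θ₂ : ℝ, 0 ≤ θ₀ ∧ θ₀ ≤ 1 ∧ 0 ≤ θ₁ ∧ θ₁ ≤ 1 ∧ 0 ≤ θ₂ ∧ θ₂ ≤ 1 ∧
        (∀ j, G j (θ₀ + θ₂) θ₁ ≤ r j ∧ G j (θ₀ + θ₁) θ₂ ≤ r j ∧ G j (θ₁ + θ₂) θ₀ ≤ r j) ∧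
        η * R ^ (-θS) ≤ θ₀ + t * θ₁ + R * θ₂ - (1 + R))
    {c A t₀ : ℝ} (hc : 0 < c) (hA : θS < A) (ht₀ : t₀ < 1) :
    ∃ t : ℝ, t₀ ≤ t ∧ t < 1 ∧
      ∃ θ₀ θ₁ θ₂ : ℝ, 0 ≤ θ₀ ∧ θ₀ ≤ 1 ∧ 0 ≤ θ₁ ∧ θ₁ ≤ 1 ∧ 0 ≤ θ₂ ∧ θ₂ ≤ 1 ∧
        (∀ j, G j (θ₀ + θ₂) θ₁ ≤ r j ∧ G j (θ₀ + θ₁) θ₂ ≤ r j ∧ G j (θ₁ + θ₂) θ₀ ≤ r j) ∧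
        Real.exp (-(A * c / (1 - t))) <
          θ₀ + t * θ₁ + Real.exp (c / (1 - t)) * θ₂ - (1 + Real.exp (c / (1 - t))) := by
  obtain ⟨η, R₀, hη, hR₀, W⟩ := W
  have hapos : 0 < A - θS := by linarith
  obtain ⟨R₂, hR₂⟩ : ∃ R₂ : ℝ, R₂ = (2 / η) ^ (A - θS)⁻¹ := ⟨_, rfl⟩
  have hR₂pos : 0 < R₂ := by rw [hR₂]; exact Real.rpow_pos_of_pos (by positivity) _
  obtain ⟨R₁, hR₁⟩ : ∃ R₁ : ℝ, R₁ = max (max R₀ R₂) 1 := ⟨_, rfl⟩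
  have hR₁1 : 1 ≤ R₁ := by rw [hR₁]; exact le_max_right _ _
  have hR₁0 : R₀ ≤ R₁ := by rw [hR₁]; exact (le_max_left _ _).trans (le_max_left _ _)
  have hR₁2 : R₂ ≤ R₁ := by rw [hR₁]; exact (le_max_right _ _).trans (le_max_left _ _)
  obtain ⟨M, hM⟩ : ∃ M : ℝ, M = Real.log R₁ + 1 := ⟨_, rfl⟩
  have hMpos : 0 < M := by rw [hM]; linarith [Real.log_nonneg hR₁1]
  obtain ⟨t, ht⟩ : ∃ t : ℝ, t = max (max t₀ (1 / 2)) (1 - c / M) := ⟨_, rfl⟩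
  have hcM : 0 < c / M := div_pos hc hMpos
  have ht1 : t < 1 := by rw [ht]; exact max_lt (max_lt ht₀ (by norm_num)) (by linarith)
  have ht₀t : t₀ ≤ t := by rw [ht]; exact (le_max_left _ _).trans (le_max_left _ _)
  have hthalf : 1 / 2 ≤ t := by rw [ht]; exact (le_max_right _ _).trans (le_max_left _ _)
  have htM : 1 - c / M ≤ t := by rw [ht]; exact le_max_right _ _
  have hs : 0 < 1 - t := by linarith
  obtain ⟨R, hRdef⟩ : ∃ R : ℝ, R = Real.exp (c / (1 - t)) := ⟨_, rfl⟩
  have hRpos : 0 < R := by rw [hRdef]; exact Real.exp_pos _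
  have hMle : M ≤ c / (1 - t) := by
    rw [le_div_iff₀ hs]
    have : M * (1 - t) ≤ M * (c / M) := mul_le_mul_of_nonneg_left (by linarith) hMpos.le
    rw [mul_div_cancel₀ _ hMpos.ne'] at this
    linarith
  have hR₁R : R₁ ≤ R := by
    rw [hRdef]
    calc R₁ = Real.exp (Real.log R₁) := (Real.exp_log (by linarith)).symm
      _ ≤ Real.exp M := Real.exp_le_exp.2 (by rw [hM]; linarith)
      _ ≤ Real.exp (c / (1 - t)) := Real.exp_le_exp.2 hMle
  obtain ⟨θ₀, θ₁, θ₂, h00, h01, h10, h11, h20, h21, hpass, hE⟩ :=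
    W t R hthalf ht1.le (hR₁0.trans hR₁R)
  refine ⟨t, ht₀t, ht1, θ₀, θ₁, θ₂, h00, h01, h10, h11, h20, h21, hpass, ?_⟩
  -- `exp(−Ac/(1−t)) = R^(−A) = R^(−θS)·R^(−(A−θS)) ≤ R^(−θS)·η/2 < η·R^(−θS) ≤ excess`
  have hexp : Real.exp (-(A * c / (1 - t))) = R ^ (-θS) * R ^ (-(A - θS)) := by
    rw [← Real.rpow_add hRpos, hRdef, ← Real.exp_mul]
    congr 1
    ring
  have hRa : R ^ (-(A - θS)) ≤ η / 2 := by
    have h1 : R ^ (-(A - θS)) ≤ R₂ ^ (-(A - θS)) :=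
      Real.rpow_le_rpow_of_nonpos hR₂pos (hR₁2.trans hR₁R) (by linarith)
    have h2 : R₂ ^ (-(A - θS)) = η / 2 := by
      rw [hR₂, ← Real.rpow_mul (by positivity), show (A - θS)⁻¹ * -(A - θS) = -1 by field_simp,
        Real.rpow_neg_one, inv_div]
    exact h1.trans h2.le
  have hRθpos : 0 < R ^ (-θS) := Real.rpow_pos_of_pos hRpos _
  rw [← hRdef, hexp]
  nlinarith [mul_le_mul_of_nonneg_left hRa hRθpos.le]

/-! ## §4 The thin ceiling of the tower of record: K48-V answered -/

/-- **THE THIN CEILING of the certified isolated `E₃` tower (every field) — K48-V answered NO at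
instrument level.**  A chain (`r₀ = 10`, `Q₀ = 4`, `L₀ = 3`, `G₀(s,t) = 3^s`, `Q+2L = r`, `L' = (Q+L)²−Q²`,
`r' = r²`, `G' = (Q^t+G)²−(Q^t)²`) whose readouts pass at every sub-tangent point, such that (a) every
universal spectral point passes every readout at its three shadows; (b) for `t ∈ [1/2,1]`, `R ≥ R₀`
some point of `[0,1]³` passing every readout at all three shadows has thin excess `≥ η·R^(−θ_S)` —
the TRUE excess being `≤ A·R^(−θ_S)` (`thinExcess_le_rpow`); (c) for every `c > 0`, `A > θ_S`, `t₀ < 1`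
some `t ∈ [t₀,1)` and admissible point EXCEED `e^{−Ac/(1−t)}` at `R = e^{c/(1−t)}`: no thin-excess
bound beyond `θ_S` (lens 1's `ThinExcessBound K c A`, `A > θ_S`) follows from the tower.
[cite: Schonhage1981, §5] [cite: Pan1984, Props. 16.2–16.5] [cite: Stothers2010, Thm. 8] -/
theorem thinCeiling_sandwich :
    ∃ (r Q L : ℕ → ℕ) (G : ℕ → ℝ → ℝ → ℝ),
      r 0 = 10 ∧ Q 0 = 4 ∧ L 0 = 3 ∧ (∀ s t : ℝ, G 0 s t = (3 : ℝ) ^ s) ∧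
      (∀ j, Q j + 2 * L j = r j) ∧ (∀ j, L (j + 1) = (Q j + L j) ^ 2 - Q j ^ 2) ∧
      (∀ j, r (j + 1) = r j ^ 2) ∧
      (∀ j (s t : ℝ), G (j + 1) s t =
        (((Q j : ℕ) : ℝ) ^ t + G j s t) ^ 2 - (((Q j : ℕ) : ℝ) ^ t) ^ 2) ∧
      (∀ j (s t : ℝ), (∀ y : ℝ, 0 ≤ y → s + y * t ≤ omegaRect K 1 y 1) → G j s t ≤ r j) ∧
      (∀ F : SpectralMap K, IsUniversalSpectralPoint K F → ∀ j,
        G j (specMMPoint K F 0 + specMMPoint K F 2) (specMMPoint K F 1) ≤ r j ∧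
        G j (specMMPoint K F 0 + specMMPoint K F 1) (specMMPoint K F 2) ≤ r j ∧
        G j (specMMPoint K F 1 + specMMPoint K F 2) (specMMPoint K F 0) ≤ r j) ∧
      (∃ η R₀ : ℝ, 0 < η ∧ 0 < R₀ ∧ ∀ t R : ℝ, 1 / 2 ≤ t → t ≤ 1 → R₀ ≤ R →
        ∃ θ₀ θ₁ θ₂ : ℝ, 0 ≤ θ₀ ∧ θ₀ ≤ 1 ∧ 0 ≤ θ₁ ∧ θ₁ ≤ 1 ∧ 0 ≤ θ₂ ∧ θ₂ ≤ 1 ∧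
          (∀ j, G j (θ₀ + θ₂) θ₁ ≤ r j ∧ G j (θ₀ + θ₁) θ₂ ≤ r j ∧ G j (θ₁ + θ₂) θ₀ ≤ r j) ∧
          η * R ^ (-(Real.logb 2 ((4 : ℝ) / 3) / (1 - Real.logb 2 ((4 : ℝ) / 3)))) ≤
            θ₀ + t * θ₁ + R * θ₂ - (1 + R)) ∧
      (∀ c A t₀ : ℝ, 0 < c → Real.logb 2 ((4 : ℝ) / 3) / (1 - Real.logb 2 ((4 : ℝ) / 3)) < A →
        t₀ < 1 → ∃ t : ℝ, t₀ ≤ t ∧ t < 1 ∧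
          ∃ θ₀ θ₁ θ₂ : ℝ, 0 ≤ θ₀ ∧ θ₀ ≤ 1 ∧ 0 ≤ θ₁ ∧ θ₁ ≤ 1 ∧ 0 ≤ θ₂ ∧ θ₂ ≤ 1 ∧
            (∀ j, G j (θ₀ + θ₂) θ₁ ≤ r j ∧ G j (θ₀ + θ₁) θ₂ ≤ r j ∧ G j (θ₁ + θ₂) θ₀ ≤ r j) ∧
            Real.exp (-(A * c / (1 - t))) <
              θ₀ + t * θ₁ + Real.exp (c / (1 - t)) * θ₂ - (1 + Real.exp (c / (1 - t)))) := by
  obtain ⟨r, Q, L, G, h0r, h0Q, h0L, h0G, hsum, hL, hr, hG, hread, -, ⟨c, hc, hw⟩, -⟩ :=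
    isolatedTower_sandwich K
  have hW := thin_witness r Q L G h0r h0Q h0G hsum hL hr hG hc hw
  exact ⟨r, Q, L, G, h0r, h0Q, h0L, h0G, hsum, hL, hr, hG, hread,
    fun F hF j => plane_certificate r G hread hF j, hW,
    fun c' A t₀ hc' hA ht₀ => notCertified_of_witness r G hW hc' hA ht₀⟩

end Summit.MatrixMultiplication.MatrixMultiplication.Theorems.FarEdgeDescentThinCeiling

end
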